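import Mathlib
import Summits.KontsevichZagierPeriods.Zeta5Search.KDigitProof
import Summits.KontsevichZagierPeriods.Zeta5Search.PalindromicUBound
import Summits.KontsevichZagierPeriods.Zeta5Search.MixedPairs
import HarnessLib

/-!
# ζ(5) search — the PALINDROMIC `𝒦`-CLASS BOUND and LEMMA S are THEOREMS (`PalindromicClassKBound`, `SymmetricClassKBound`)

Cell `pub-zeta5` (HONEST FRAMING: systematic search; no irrationality claim unless certified), typer seat
generation 9.  Discharges BY NAME

* `PalindromicClassKBound` (gen-2 g9, `Zeta5Search/MixedPairs.lean`; exact check 20,883 classes): a multipole class with `E_x ≤ −3`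
  has `v_p(𝒦_x) ≥ classBound b p x 3 = 3 + E_x + [configuration palindromic ∧ E_x even]`;
* `SymmetricClassKBound` = LEMMA S of gen-2 g8 (`Zeta5Search/ClusterValuationPairs.lean` §3c; 1,018 classes + exhaustive `n ≤ 13`):
  a two-point class of shape `(−a,−a)`, `a ≥ 2`, not self-conjugate, has `v_p(𝒦_x) ≥ 4 + E_x`.

PROOF.  `ĉ_x = 0` for a class with EVEN `E_x ≤ −3` admitting a level-reversing involution `τ` of its non-neutral points
(`cHat_eq_zero_of_invol`: `ρ_{τq,1} = −ρ_{q,1}`, `ρ_{τq,2} = ρ_{q,2}` by `classRho_invol` (palindrome lemma, typer g9), `ℓ_{τq} = L − ℓ_q`,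
and the `L`-terms vanish by the residue identities `Σρ₁ = 0`, `Σ(ρ₂ + ℓρ₁) = 0` (`rhoResidueIdentities_holds`), so `ĉ_x = −ĉ_x`);
palindromic configurations and self-conjugate classes admit such an involution (`exists_invol_of_palindromic/centreIn`, typer g9), and
so does a two-point class `(−a,−a)` (the swap).  Then U-K (`kDigit_holds`, typer g9): `v(𝒦_x − (−p)^{E+1}p²ĝ_q·0) ≥ E_x + 4`.  The
non-palindromic case of `PalindromicClassKBound` is `multipoleClassKBound_holds` (typer g8).  `p`-adic valuations of rationals; nothing
about irrationality.
-/

noncomputable section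

open Finset

namespace Summit.KontsevichZagierPeriods.Zeta5Search.ClusterValuation

open Summit.KontsevichZagierPeriods.Zeta5Search.DualSeries (InBox)
open Summit.KontsevichZagierPeriods.Zeta5Search.CasoratianValuation (InPolytope)
open Summit.KontsevichZagierPeriods.Zeta5Search.PadicSeries

/-! ### `ĉ_x = 0` under a level-reversing involution (even `E_x`) -/

section Invol

variable (b : ℕ → ℤ) {p x : ℕ} (τ : ℕ → ℕ)
  (hD : ∀ s ∈ (classSet b p x).filter (fun s => netExp b s ≠ 0), τ s ∈ (classSet b p x).filter (fun s => netExp b s ≠ 0))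
  (hinv : ∀ s ∈ (classSet b p x).filter (fun s => netExp b s ≠ 0), τ (τ s) = s)
  (he : ∀ s ∈ (classSet b p x).filter (fun s => netExp b s ≠ 0), netExp b (τ s) = netExp b s)
  (hlin : ∀ s ∈ (classSet b p x).filter (fun s => netExp b s ≠ 0), ∀ t ∈ (classSet b p x).filter (fun s => netExp b s ≠ 0),
    ((τ s : ℚ) - τ t) = -((s : ℚ) - t))
  (hcen : (¬ (2 : ℤ) ∣ b 0 ∧ CentreIn b p x) → ∀ s ∈ (classSet b p x).filter (fun s => netExp b s ≠ 0),
    (τ s : ℚ) - (b 0 : ℚ) / 2 = -((s : ℚ) - (b 0 : ℚ) / 2))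

include hD hinv he hlin hcen in
/-- **`ĉ_x = 0`** for a class with even `E_x` admitting a level-reversing involution, given the two residue identities. -/
theorem cHat_eq_zero_of_invol (hp : 0 < p) (heven : Even (classExp b p x))
    (hS1 : ∑ q ∈ classPoles b p x, classRho b p q 1 = 0)
    (hS2 : ∑ q ∈ classPoles b p x,
      ((if netExp b q ≤ -2 then classRho b p q 2 else 0) + ((q / p : ℕ) : ℚ) * classRho b p q 1) = 0) :
    cHat b p x = 0 := by
  set D := (classSet b p x).filter (fun s => netExp b s ≠ 0) with hDdef
  set P := classPoles b p x with hPdef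
  have hPD : ∀ s ∈ P, s ∈ D := fun s hs => by
    obtain ⟨hs1, hs2⟩ := mem_filter.1 hs
    exact mem_filter.2 ⟨hs1, by omega⟩
  have hτP : ∀ s ∈ P, τ s ∈ P := fun s hs => by
    have hsD := hPD s hs
    refine mem_filter.2 ⟨(mem_filter.1 (hD s hsD)).1, ?_⟩
    rw [he s hsD]; exact (mem_filter.1 hs).2
  by_cases hPe : P = ∅
  · unfold cHat; rw [← hPdef, hPe, sum_empty]
  obtain ⟨q₀, hq₀⟩ := nonempty_iff_ne_empty.2 hPe
  -- the common level sum `ℓ_{τq} + ℓ_q = L`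
  set L : ℚ := ((τ q₀ / p : ℕ) : ℚ) + ((q₀ / p : ℕ) : ℚ) with hL
  have hlvl : ∀ q ∈ P, ((τ q / p : ℕ) : ℚ) = L - ((q / p : ℕ) : ℚ) := by
    intro q hq
    have hqD := hPD q hq
    have hq₀D := hPD q₀ hq₀
    have h1 := sub_div_eq_lvl_sub b hp (mem_filter.1 (hD q hqD)).1 (mem_filter.1 (hD q₀ hq₀D)).1
    have h2 := sub_div_eq_lvl_sub b hp (mem_filter.1 hqD).1 (mem_filter.1 hq₀D).1
    have h3 := hlin q hqD q₀ hq₀D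
    unfold lvl at h1 h2
    rw [h3, neg_div, h2] at h1
    rw [hL]
    linarith
  -- reindex `ĉ_x` by `τ`
  have hflip : cHat b p x = ∑ q ∈ P,
      ((((τ q / p : ℕ) : ℚ)) ^ 2 * classRho b p (τ q) 1
        + if netExp b (τ q) ≤ -2 then 2 * ((τ q / p : ℕ) : ℚ) * classRho b p (τ q) 2 else 0) := by
    unfold cHat
    exact (sum_nbij' τ τ hτP hτP (fun s hs => hinv s (hPD s hs)) (fun s hs => hinv s (hPD s hs)) (fun _ _ => rfl)).symm
  have hodd1 : Odd (classExp b p x + ((1 : ℕ) : ℤ)) := by push_cast; exact heven.add_odd odd_one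
  have heven2 : Even (classExp b p x + ((2 : ℕ) : ℤ)) := by push_cast; exact heven.add (by decide)
  have hterm : ∀ q ∈ P,
      ((((τ q / p : ℕ) : ℚ)) ^ 2 * classRho b p (τ q) 1
        + if netExp b (τ q) ≤ -2 then 2 * ((τ q / p : ℕ) : ℚ) * classRho b p (τ q) 2 else 0) =
      -((((q / p : ℕ) : ℚ)) ^ 2 * classRho b p q 1
          + if netExp b q ≤ -2 then 2 * ((q / p : ℕ) : ℚ) * classRho b p q 2 else 0)
        + (-(L ^ 2 * classRho b p q 1)
          + 2 * L * ((if netExp b q ≤ -2 then classRho b p q 2 else 0) + ((q / p : ℕ) : ℚ) * classRho b p q 1)) := by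
    intro q hq
    have hqD := hPD q hq
    have hqn : q ≤ (b 0).toNat := le_of_mem_classSet b (mem_filter.1 hq).1
    have hqpole : netExp b q < 0 := (mem_filter.1 hq).2
    rw [he q hqD, hlvl q hq, classRho_invol b τ hD hinv he hlin hcen hqD hqn (by push_cast; omega), hodd1.neg_one_zpow]
    by_cases h2 : netExp b q ≤ -2
    · rw [if_pos h2, if_pos h2, if_pos h2, classRho_invol b τ hD hinv he hlin hcen hqD hqn (by push_cast; omega),
        heven2.neg_one_zpow]
      ring
    · rw [if_neg h2, if_neg h2, if_neg h2]
      ring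
  have hG : ∑ q ∈ P, (-(L ^ 2 * classRho b p q 1)
      + 2 * L * ((if netExp b q ≤ -2 then classRho b p q 2 else 0) + ((q / p : ℕ) : ℚ) * classRho b p q 1)) = 0 := by
    rw [sum_add_distrib, sum_neg_distrib, ← mul_sum, ← mul_sum, hS1, hS2]
    ring
  have hc : cHat b p x = -cHat b p x + 0 := by
    calc cHat b p x = _ := hflip
      _ = _ := sum_congr rfl hterm
      _ = -cHat b p x + 0 := by rw [sum_add_distrib, sum_neg_distrib, hG]; rfl
  linarith

end Invol

/-! ### Palindromic and self-conjugate classes: `ĉ_x = 0` for even `E_x ≤ −3` -/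

/-- **`ĉ_x = 0`** for a palindromic configuration (or a self-conjugate class) with even `E_x ≤ −3`. -/
theorem cHat_eq_zero_of_palindromic (b : ℕ → ℤ) {p x : ℕ} (hb : InPolytope b) (hprime : p.Prime) (hp5 : 5 ≤ p)
    (hwin : (b 0 + 2 : ℤ) < (p : ℤ) ^ 2) (hx : x < p) (hpal : IsPalindromic (classConfig b p x))
    (hE3 : classExp b p x ≤ -3) (heven : Even (classExp b p x)) : cHat b p x = 0 := by
  obtain ⟨hS1, hS2, -⟩ := rhoResidueIdentities_holds b p x hb hprime hp5 hwin hx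
  by_cases hcx : CentreIn b p x
  · obtain ⟨τ, hD, hinv, he, hlin, hcen⟩ := exists_invol_of_centreIn b hb.1.1 hcx
    exact cHat_eq_zero_of_invol b τ hD hinv he hlin hcen hprime.pos heven (hS1 (by omega)) (hS2 hE3)
  · obtain ⟨τ, hD, hinv, he, hlin, hcen⟩ := exists_invol_of_palindromic b hcx hpal
    exact cHat_eq_zero_of_invol b τ hD hinv he hlin hcen hprime.pos heven (hS1 (by omega)) (hS2 hE3)

/-- **`PalindromicClassKBound` is a theorem.** -/
theorem palindromicClassKBound_holds : PalindromicClassKBound := by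
  intro b p x hb hprime hp5 _hpb hwin hx hmulti hE3 hne
  haveI : Fact p.Prime := ⟨hprime⟩
  unfold classBound
  rw [if_pos hmulti]
  split_ifs with hpal
  · obtain ⟨q, hq⟩ := card_pos.1 (by unfold classPoleCount at hmulti; omega :
      0 < ((classSet b p x).filter fun s => netExp b s < 0).card)
    obtain ⟨hqC, hqpole⟩ := mem_filter.1 hq
    have heven : Even (classExp b p x) := by
      obtain ⟨k, hk⟩ := hpal.2
      exact ⟨k - 1, by omega⟩
    have hc0 := cHat_eq_zero_of_palindromic b hb hprime hp5 hwin hx hpal.1 hE3 heven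
    have hdig := kDigit_holds b p x q hb hprime hp5 hwin hx hqC hqpole hE3
    rw [hc0, mul_zero, sub_zero] at hdig
    have := hdig hne
    push_cast
    linarith
  · have := multipoleClassKBound_holds b p x hb hprime hp5 hwin hx (by omega) hne
    push_cast
    linarith

/-! ### Lemma S: two-point classes `(−a,−a)` -/

/-- **`SymmetricClassKBound` (LEMMA S of gen-2 g8) is a theorem**: `v_p(𝒦_x) ≥ 4 + E_x` for a two-point class `(−a,−a)`, `a ≥ 2`,
not self-conjugate. -/
theorem symmetricClassKBound_holds : SymmetricClassKBound := by
  intro b p x a hb hprime hp5 _hpb hwin hx hcard hall ha hcx hne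
  haveI : Fact p.Prime := ⟨hprime⟩
  have hp0 : 0 < p := hprime.pos
  obtain ⟨u, v, huv, hCuv⟩ := card_eq_two.1 hcard
  have hu : u ∈ classSet b p x := by rw [hCuv]; simp
  have hv : v ∈ classSet b p x := by rw [hCuv]; simp
  have heu : netExp b u = -a := hall u hu
  have hev : netExp b v = -a := hall v hv
  -- the class exponent `E_x = −2a`
  have hE : classExp b p x = -2 * a := by
    unfold classExp
    rw [if_neg (fun h => hcx h.2), add_zero, hCuv, sum_pair huv, heu, hev]
    ring
  have hE3 : classExp b p x ≤ -3 := by omega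
  have heven : Even (classExp b p x) := ⟨-a, by rw [hE]; ring⟩
  -- the swap is a level-reversing involution of the (two, non-neutral) class points
  set D := (classSet b p x).filter (fun s => netExp b s ≠ 0) with hDdef
  have hDuv : D = classSet b p x := by
    rw [hDdef]
    exact filter_true_of_mem fun s hs => by rw [hall s hs]; omega
  set τ : ℕ → ℕ := fun s => if s = u then v else u with hτ
  have hτu : τ u = v := by simp [hτ]
  have hτv : τ v = u := by simp [hτ, huv.symm]
  have hmem : ∀ s ∈ D, s = u ∨ s = v := fun s hs => by
    rw [hDuv, hCuv, mem_insert, mem_singleton] at hs; exact hs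
  have hD' : ∀ s ∈ D, τ s ∈ D := fun s hs => by
    rcases hmem s hs with rfl | rfl
    · rw [hτu, hDuv]; exact hv
    · rw [hτv, hDuv]; exact hu
  have hinv : ∀ s ∈ D, τ (τ s) = s := fun s hs => by
    rcases hmem s hs with rfl | rfl
    · rw [hτu, hτv]
    · rw [hτv, hτu]
  have he : ∀ s ∈ D, netExp b (τ s) = netExp b s := fun s hs => by
    rcases hmem s hs with rfl | rfl
    · rw [hτu, heu, hev]
    · rw [hτv, heu, hev]
  have hlin : ∀ s ∈ D, ∀ t ∈ D, ((τ s : ℚ) - τ t) = -((s : ℚ) - t) := fun s hs t ht => by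
    rcases hmem s hs with rfl | rfl <;> rcases hmem t ht with rfl | rfl
    · simp
    · rw [hτu, hτv]; ring
    · rw [hτv, hτu]; ring
    · simp
  have hcen : (¬ (2 : ℤ) ∣ b 0 ∧ CentreIn b p x) → ∀ s ∈ D, (τ s : ℚ) - (b 0 : ℚ) / 2 = -((s : ℚ) - (b 0 : ℚ) / 2) :=
    fun h => absurd h.2 hcx
  obtain ⟨hS1, hS2, -⟩ := rhoResidueIdentities_holds b p x hb hprime hp5 hwin hx
  have hc0 := cHat_eq_zero_of_invol b τ hD' hinv he hlin hcen hp0 heven (hS1 (by omega)) (hS2 hE3)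
  have hdig := kDigit_holds b p x u hb hprime hp5 hwin hx hu (by omega) hE3
  rw [hc0, mul_zero, sub_zero] at hdig
  have := hdig hne
  linarith

end Summit.KontsevichZagierPeriods.Zeta5Search.ClusterValuation

end
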